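import Mathlib
import HarnessLib
import Literature.Probability.MarkovChains.EssentialStates
import Literature.Probability.MarkovChains.StationaryDistributionExistence

/-!
# Proposition 1.29: a unique stationary distribution iff a unique essential class (Levin–Peres–Wilmer §1.7)

HONEST FRAMING: exact (Metropolis-corrected) sampling algorithms for lattice gauge theory; figures
of merit are autocorrelation/cost numbers at stated couplings and volumes; no continuum-physics claim.

Continues `EssentialStates.lean` (`Accessible`, `IsEssential`, `Communicates`, Lemmas 1.25 / 1.26,
Prop. 1.28) and `StationaryDistributionExistence.lean` (`exists_isStationary`, Cor. 1.17) in the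
conventions of `TotalVariation.lean` (`IsRowStochastic`), `MetropolisHastings.lean` (`IsStationary`),
`PeskunOrdering.lean` (`IsIrreducible`) and `GroupInverse.lean` (`IsStationary.eq_of_isIrreducible`).
Source: D. A. Levin, Y. Peres (with E. L. Wilmer), *Markov Chains and Mixing Times*, 2nd ed., AMS
2017 [LevinPeres2017], §1.7 (pp. 15–17): the restriction `P_C` to an essential class and
Proposition 1.29.  Everything is PROVED (finite sums; 0 named facts).

* `commClass P x` — the communicating class **`[x]`** as a `Finset` [cite: LevinPeres2017, §1.7 ("the
  communicating class of `x` is denoted by `[x]`")]; `classKernel P C` — **`P_C = P|_{C×C}`**, the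
  restriction of `P` to `C ⊆ X` (Mathlib's `Matrix.submatrix` along the inclusion)
  [cite: LevinPeres2017, §1.7 ("Let `P_C = P|_{C×C}` be the restriction of the matrix `P` to the set of
  states `C ⊂ X`")];
* `apply_eq_zero_of_not_mem_commClass`, `pow_apply_eq_zero_of_not_mem_commClass` — from an essential
  class no mass leaves: `P(x,z) = 0` (and `Pⁿ(x,z) = 0`) for `x ∈ [x₀]`, `z ∉ [x₀]`;
  `classKernel_isRowStochastic`, `pow_classKernel_apply` (`(P_C)ⁿ = Pⁿ` on `C × C`) and
  `classKernel_isIrreducible` — **if `C = [x]` is an essential class then `P_C` is stochastic and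
  irreducible** [cite: LevinPeres2017, §1.7 ("`P_C` is stochastic … Moreover, `P_C` is irreducible by
  definition of a communicating class")];
* `isStationary_restrict_commClass` — a stationary distribution of `P` supported on `C` restricts to a
  stationary distribution of `P_C`; `extendClass`, `isStationary_extendClass` — a stationary
  distribution of `P_C` extended by `0` is stationary for `P` [cite: LevinPeres2017, §1.7, proof of
  Prop. 1.29 ("`π` restricted to `C` is stationary for `P_C`"; "each `π_i` is stationary for `P`")];
* **PROPOSITION 1.29** `LevinPeres2017_prop_1_29` — **the transition matrix `P` has a unique stationary
  distribution if and only if there is a unique essential communicating class** (uniqueness of the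
  class stated as: all essential states communicate; existence of one is Lemma 1.26)
  [cite: LevinPeres2017, §1.7 Prop. 1.29]; the two directions separately:
  `LevinPeres2017_prop_1_29_existsUnique` and `communicates_of_existsUnique_stationary`.

Context (cell pub-lqcd, venture LatticeQCDFlow): a reducible exact sampler (e.g. one that conserves a
topological sector exactly) has one stationary distribution per closed class; Prop. 1.29 is the
precise statement that uniqueness of the sampled law is equivalent to a single essential class —
the property lost under "topological freezing" in the idealised limit of exactly conserved charge.
-/

namespace Literature.Probability.MarkovChains

open Finset Matrix

variable {X : Type*} [Fintype X] [DecidableEq X]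

open Classical in
/-- The communicating class **`[x] = {y : x ↔ y}`** of `x`, as a `Finset`.
[cite: LevinPeres2017, §1.7 ("For `x ∈ X`, the communicating class of `x` is denoted by `[x]`")] -/
noncomputable def commClass (P : Matrix X X ℝ) (x : X) : Finset X := univ.filter (Communicates P x)

/-- **`P_C = P|_{C×C}`**, the restriction of `P` to the states in `C`, as a matrix indexed by the
subtype of `C`. [cite: LevinPeres2017, §1.7 ("Let `P_C = P|_{C×C}` be the restriction of the matrix
`P` to the set of states `C ⊂ X`")] -/
def classKernel (P : Matrix X X ℝ) (C : Finset X) : Matrix C C ℝ :=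
  P.submatrix Subtype.val Subtype.val

/-- A vector on `C` extended by zero to `X` (the measures "supported on `C_i`" in the proof of
Prop. 1.29). [cite: LevinPeres2017, §1.7, proof of Prop. 1.29 (`π(x) = π_C(x)` if `x ∈ C`, `0` if
`x ∉ C`)] -/
noncomputable def extendClass (C : Finset X) (ρ : C → ℝ) : X → ℝ :=
  fun x => if h : x ∈ C then ρ ⟨x, h⟩ else 0

variable {P : Matrix X X ℝ} {π : X → ℝ}

/-- `y ∈ [x] ↔ x ↔ y`. [cite: LevinPeres2017, §1.7 (definition of `[x]`)] -/
theorem mem_commClass {x y : X} : y ∈ commClass P x ↔ Communicates P x y := by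
  unfold commClass
  simp

/-- `x ∈ [x]`. [cite: LevinPeres2017, §1.7 (definition of `[x]`)] -/
theorem self_mem_commClass (x : X) : x ∈ commClass P x :=
  mem_commClass.mpr (communicates_refl x)

/-- Members of the same class have the same class: `y ∈ [x] ⇒ [y] = [x]`. [cite: LevinPeres2017, §1.7
(the communicating classes are the equivalence classes of `↔`), Exercise 1.13] -/
theorem commClass_eq_of_mem (hP0 : ∀ x y, 0 ≤ P x y) {x y : X} (hy : y ∈ commClass P x) :
    commClass P y = commClass P x := by
  ext z
  rw [mem_commClass, mem_commClass]
  rw [mem_commClass] at hy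
  exact ⟨fun h => hy.trans hP0 h, fun h => hy.symm.trans hP0 h⟩

/-- The members of an essential class are essential. [cite: LevinPeres2017, §1.7 Lemma 1.25 ("the
states in a single communicating class are either all essential or all inessential")] -/
theorem isEssential_of_mem_commClass (hP0 : ∀ x y, 0 ≤ P x y) {x₀ y : X} (hx₀ : IsEssential P x₀)
    (hy : y ∈ commClass P x₀) : IsEssential P y := by
  rcases mem_commClass.mp hy with ⟨h1, -⟩ | rfl
  · exact LevinPeres2017_lemma_1_25 hP0 hx₀ h1
  · exact hx₀

omit [Fintype X] [DecidableEq X] in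
/-- Entries of `P_C`: `P_C(a,b) = P(a,b)`. [cite: LevinPeres2017, §1.7 (definition of `P_C`)] -/
theorem classKernel_apply (P : Matrix X X ℝ) (C : Finset X) (a b : C) :
    classKernel P C a b = P a.1 b.1 := rfl

/-! ## No mass leaves an essential class; `P_C` is stochastic and irreducible -/

/-- **`P(x,z) = 0` for `x` in an essential class `[x₀]` and `z ∉ [x₀]`** (a positive entry would give
`x → z`, hence `z → x` and `z ∈ [x₀]`). [cite: LevinPeres2017, §1.7 ("`Σ_{y∈[x]} P(x,y) = 1`, since
`P(x,z) = 0` for `z ∉ [x]`")] -/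
theorem apply_eq_zero_of_not_mem_commClass (hP : IsRowStochastic P) {x₀ x z : X}
    (hx₀ : IsEssential P x₀) (hx : x ∈ commClass P x₀) (hz : z ∉ commClass P x₀) : P x z = 0 := by
  by_contra h
  have hpos : 0 < P x z := lt_of_le_of_ne (hP.1 x z) (Ne.symm h)
  have hxz : Accessible P x z := accessible_of_apply_pos hpos
  have hzx : Accessible P z x := isEssential_of_mem_commClass hP.1 hx₀ hx z hxz
  exact hz (mem_commClass.mpr ((mem_commClass.mp hx).trans hP.1 (Or.inl ⟨hxz, hzx⟩)))

/-- The chain started in an essential class stays there: `Pⁿ(x,z) = 0` for `x ∈ [x₀]`, `z ∉ [x₀]`.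
[cite: LevinPeres2017, §1.7 ("`P(x,z) = 0` for `z ∉ [x]`", iterated)] -/
theorem pow_apply_eq_zero_of_not_mem_commClass (hP : IsRowStochastic P) {x₀ x z : X}
    (hx₀ : IsEssential P x₀) (hx : x ∈ commClass P x₀) (hz : z ∉ commClass P x₀) (n : ℕ) :
    (P ^ n) x z = 0 := by
  induction n generalizing z with
  | zero =>
    have hne : x ≠ z := fun h => hz (h ▸ hx)
    rw [pow_zero, one_apply_ne hne]
  | succ n ih =>
    rw [pow_succ, mul_apply]
    refine sum_eq_zero fun w _ => ?_
    by_cases hw : w ∈ commClass P x₀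
    · rw [apply_eq_zero_of_not_mem_commClass hP hx₀ hw hz, mul_zero]
    · rw [ih hw, zero_mul]

omit [DecidableEq X] in
/-- A sum over `X` of a function vanishing off `C` is the sum over the subtype `C`.
[cite: LevinPeres2017, §1.7, proof of Prop. 1.28 / 1.29 (splitting `Σ_{y∈X}` into `y ∈ C` and
`y ∉ C`)] -/
theorem sum_eq_sum_coe_of_zero_off {C : Finset X} {f : X → ℝ} (hf : ∀ x, x ∉ C → f x = 0) :
    ∑ x, f x = ∑ a : C, f a.1 := by
  rw [Finset.sum_coe_sort C f]
  exact (sum_subset (subset_univ C) fun x _ hx => hf x hx).symm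

/-- **`P_C` is stochastic for an essential class `C = [x₀]`.** [cite: LevinPeres2017, §1.7 ("If
`C = [x]` is an essential class, then `P_C` is stochastic")] -/
theorem classKernel_isRowStochastic (hP : IsRowStochastic P) {x₀ : X} (hx₀ : IsEssential P x₀) :
    IsRowStochastic (classKernel P (commClass P x₀)) := by
  refine ⟨fun a b => hP.1 a.1 b.1, fun a => ?_⟩
  simp_rw [classKernel_apply]
  rw [← sum_eq_sum_coe_of_zero_off fun z hz => apply_eq_zero_of_not_mem_commClass hP hx₀ a.2 hz]
  exact hP.2 a.1

/-- **`(P_C)ⁿ(a,b) = Pⁿ(a,b)` on an essential class** (the powers of the restriction are the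
restricted powers, because no mass leaves `C`). [cite: LevinPeres2017, §1.7 (`P_C` stochastic and
irreducible for an essential class `C`)] -/
theorem pow_classKernel_apply (hP : IsRowStochastic P) {x₀ : X} (hx₀ : IsEssential P x₀) (n : ℕ)
    (a b : commClass P x₀) : (classKernel P (commClass P x₀) ^ n) a b = (P ^ n) a.1 b.1 := by
  induction n generalizing b with
  | zero =>
    by_cases h : a = b
    · subst h
      rw [pow_zero, pow_zero, one_apply_eq, one_apply_eq]
    · have h' : a.1 ≠ b.1 := fun h' => h (Subtype.ext h')
      rw [pow_zero, pow_zero, one_apply_ne h, one_apply_ne h']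
  | succ n ih =>
    rw [pow_succ, mul_apply, pow_succ, mul_apply]
    rw [sum_eq_sum_coe_of_zero_off (C := commClass P x₀) fun z hz => by
      rw [pow_apply_eq_zero_of_not_mem_commClass hP hx₀ a.2 hz n, zero_mul]]
    exact sum_congr rfl fun c _ => by rw [ih c, classKernel_apply]

/-- **`P_C` is irreducible for an essential class `C = [x₀]`.** [cite: LevinPeres2017, §1.7
("Moreover, `P_C` is irreducible by definition of a communicating class")] -/
theorem classKernel_isIrreducible (hP : IsRowStochastic P) {x₀ : X} (hx₀ : IsEssential P x₀) :
    IsIrreducible (classKernel P (commClass P x₀)) := by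
  intro a b
  have hab : Communicates P a.1 b.1 :=
    (mem_commClass.mp a.2).symm.trans hP.1 (mem_commClass.mp b.2)
  rcases hab with ⟨⟨r, -, hr⟩, -⟩ | h
  · exact ⟨r, by rwa [pow_classKernel_apply hP hx₀]⟩
  · have : a = b := Subtype.ext h
    subst this
    exact ⟨0, by rw [pow_zero, one_apply_eq]; exact one_pos⟩

/-! ## Restricting and extending stationary distributions -/

/-- **A stationary vector supported on an essential class restricts to a stationary vector of `P_C`**
("`π` restricted to `C` is stationary for `P_C`"). [cite: LevinPeres2017, §1.7, proof of Prop. 1.29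
(the display `π(x) = Σ_{y∈X} π(y)P(y,x) = Σ_{y∈C} π(y)P_C(y,x)`)] -/
theorem isStationary_restrict_commClass {x₀ : X} (hπ : IsStationary π P)
    (hsupp : ∀ z, z ∉ commClass P x₀ → π z = 0) :
    IsStationary (fun a : commClass P x₀ => π a.1) (classKernel P (commClass P x₀)) := by
  intro b
  simp_rw [classKernel_apply]
  rw [← sum_eq_sum_coe_of_zero_off (f := fun y => π y * P y b.1) fun z hz => by
    rw [hsupp z hz, zero_mul]]
  exact hπ b.1

omit [Fintype X] in
/-- `extendClass` on `C`. [cite: LevinPeres2017, §1.7, proof of Prop. 1.29] -/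
theorem extendClass_apply_mem [Fintype X] {C : Finset X} (ρ : C → ℝ) {x : X} (hx : x ∈ C) :
    extendClass C ρ x = ρ ⟨x, hx⟩ := dif_pos hx

omit [Fintype X] in
/-- `extendClass` off `C`. [cite: LevinPeres2017, §1.7, proof of Prop. 1.29] -/
theorem extendClass_apply_not_mem [Fintype X] {C : Finset X} (ρ : C → ℝ) {x : X} (hx : x ∉ C) :
    extendClass C ρ x = 0 := dif_neg hx

/-- Total mass is preserved by the extension. [cite: LevinPeres2017, §1.7, proof of Prop. 1.29] -/
theorem sum_extendClass {C : Finset X} (ρ : C → ℝ) : ∑ x, extendClass C ρ x = ∑ a : C, ρ a := by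
  rw [sum_eq_sum_coe_of_zero_off (C := C) fun x hx => extendClass_apply_not_mem ρ hx]
  exact sum_congr rfl fun a _ => by rw [extendClass_apply_mem ρ a.2]

/-- **A stationary vector of `P_C` (essential class `C`), extended by zero, is stationary for `P`**
("it is easily verified that each `π_i` is stationary for `P`"). [cite: LevinPeres2017, §1.7, proof of
Prop. 1.29] -/
theorem isStationary_extendClass (hP : IsRowStochastic P) {x₀ : X} (hx₀ : IsEssential P x₀)
    {ρ : commClass P x₀ → ℝ} (hρ : IsStationary ρ (classKernel P (commClass P x₀))) :
    IsStationary (extendClass (commClass P x₀) ρ) P := by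
  intro y
  rw [sum_eq_sum_coe_of_zero_off (C := commClass P x₀) fun x hx => by
    rw [extendClass_apply_not_mem ρ hx, zero_mul]]
  simp_rw [fun a : commClass P x₀ => extendClass_apply_mem ρ a.2]
  by_cases hy : y ∈ commClass P x₀
  · rw [extendClass_apply_mem ρ hy]
    exact hρ ⟨y, hy⟩
  · rw [extendClass_apply_not_mem ρ hy]
    exact sum_eq_zero fun a _ => by
      rw [apply_eq_zero_of_not_mem_commClass hP hx₀ a.2 hy, mul_zero]

/-! ## Proposition 1.29 -/

/-- **PROPOSITION 1.29, "if"**: if all essential states communicate (a unique essential class), then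
`P` has a unique stationary distribution.  As printed: every stationary `π` vanishes off the class
`C` (Prop. 1.28), restricts to a stationary distribution of the irreducible stochastic `P_C`, and is
therefore determined (uniqueness for `P_C`, Cor. 1.17). [cite: LevinPeres2017, §1.7 Prop. 1.29] -/
theorem LevinPeres2017_prop_1_29_existsUnique [Nonempty X] (hP : IsRowStochastic P)
    (huniq : ∀ x y, IsEssential P x → IsEssential P y → Communicates P x y) :
    ∃! π : X → ℝ, (∀ x, 0 ≤ π x) ∧ ∑ x, π x = 1 ∧ IsStationary π P := by
  obtain ⟨x₀, hx₀⟩ := LevinPeres2017_lemma_1_26 (P := P) hP.1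
  -- every state outside `[x₀]` is inessential, so stationary distributions vanish there
  have hsupp : ∀ {π : X → ℝ}, (∀ x, 0 ≤ π x) → IsStationary π P →
      ∀ z, z ∉ commClass P x₀ → π z = 0 := by
    intro π hπ0 hπ z hz
    refine LevinPeres2017_prop_1_28 hP hπ hπ0 fun hzess => hz ?_
    exact mem_commClass.mpr (huniq x₀ z hx₀ hzess)
  have hQ := classKernel_isRowStochastic hP hx₀
  have hQirr := classKernel_isIrreducible hP hx₀
  obtain ⟨π, hπ0, hπ1, hπ⟩ := exists_isStationary hP
  refine ⟨π, ⟨hπ0, hπ1, hπ⟩, fun π' ⟨hπ'0, hπ'1, hπ'⟩ => ?_⟩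
  -- both restrictions are stationary distributions of `P_C`, hence equal
  have hmass : ∀ {ρ : X → ℝ}, (∀ z, z ∉ commClass P x₀ → ρ z = 0) → ∑ x, ρ x = 1 →
      ∑ a : commClass P x₀, ρ a.1 = 1 := by
    intro ρ h0 h1
    rwa [sum_eq_sum_coe_of_zero_off (C := commClass P x₀) h0] at h1
  have heq := IsStationary.eq_of_isIrreducible hQ (hmass (hsupp hπ0 hπ) hπ1)
    (isStationary_restrict_commClass hπ (hsupp hπ0 hπ)) hQirr (hmass (hsupp hπ'0 hπ') hπ'1)
    (isStationary_restrict_commClass hπ' (hsupp hπ'0 hπ'))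
  funext z
  by_cases hz : z ∈ commClass P x₀
  · exact congrFun heq ⟨z, hz⟩
  · rw [hsupp hπ'0 hπ' z hz, hsupp hπ0 hπ z hz]

/-- **PROPOSITION 1.29, "only if"**: if `P` has a unique stationary distribution then any two essential
states communicate (there is only one essential class).  As printed: two distinct essential classes
`C₁, C₂` carry stationary distributions `π₁, π₂` of `P_{C₁}, P_{C₂}`, which extended by zero are two
different stationary distributions of `P`. [cite: LevinPeres2017, §1.7 Prop. 1.29] -/
theorem communicates_of_existsUnique_stationary (hP : IsRowStochastic P)
    (h : ∃! π : X → ℝ, (∀ x, 0 ≤ π x) ∧ ∑ x, π x = 1 ∧ IsStationary π P)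
    {x y : X} (hx : IsEssential P x) (hy : IsEssential P y) : Communicates P x y := by
  by_contra hxy
  -- the classes `[x]`, `[y]` are disjoint
  have hdisj : ∀ z, z ∈ commClass P x → z ∉ commClass P y := fun z hzx hzy =>
    hxy ((mem_commClass.mp hzx).trans hP.1 (mem_commClass.mp hzy).symm)
  -- stationary distributions of the two restrictions, extended by zero
  haveI : Nonempty (commClass P x) := ⟨⟨x, self_mem_commClass x⟩⟩
  haveI : Nonempty (commClass P y) := ⟨⟨y, self_mem_commClass y⟩⟩
  obtain ⟨ρ₁, hρ₁0, hρ₁1, hρ₁⟩ := exists_isStationary (classKernel_isRowStochastic hP hx)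
  obtain ⟨ρ₂, hρ₂0, hρ₂1, hρ₂⟩ := exists_isStationary (classKernel_isRowStochastic hP hy)
  set π₁ := extendClass (commClass P x) ρ₁ with hπ₁
  set π₂ := extendClass (commClass P y) ρ₂ with hπ₂
  have hnn : ∀ {C : Finset X} {ρ : C → ℝ}, (∀ a, 0 ≤ ρ a) → ∀ z, 0 ≤ extendClass C ρ z := by
    intro C ρ hρ z
    by_cases hz : z ∈ C
    · rw [extendClass_apply_mem ρ hz]; exact hρ _
    · rw [extendClass_apply_not_mem ρ hz]
  have h1 : (∀ z, 0 ≤ π₁ z) ∧ ∑ z, π₁ z = 1 ∧ IsStationary π₁ P :=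
    ⟨hnn hρ₁0, by rw [hπ₁, sum_extendClass, hρ₁1], isStationary_extendClass hP hx hρ₁⟩
  have h2 : (∀ z, 0 ≤ π₂ z) ∧ ∑ z, π₂ z = 1 ∧ IsStationary π₂ P :=
    ⟨hnn hρ₂0, by rw [hπ₂, sum_extendClass, hρ₂1], isStationary_extendClass hP hy hρ₂⟩
  have heq : π₁ = π₂ := h.unique h1 h2
  -- `π₁` charges some state of `[x]`, where `π₂` vanishes
  obtain ⟨a, -, ha⟩ := exists_ne_zero_of_sum_ne_zero
    (s := (univ : Finset (commClass P x))) (f := ρ₁) (by rw [hρ₁1]; exact one_ne_zero)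
  have e1 : π₁ a.1 = ρ₁ a := by rw [hπ₁, extendClass_apply_mem ρ₁ a.2]
  have e2 : π₂ a.1 = 0 := by rw [hπ₂, extendClass_apply_not_mem ρ₂ (hdisj a.1 a.2)]
  rw [heq, e2] at e1
  exact ha e1.symm

/-- **PROPOSITION 1.29**: the transition matrix `P` has a unique stationary distribution if and only if
there is a unique essential communicating class (on a nonempty finite state space an essential class
always exists, Lemma 1.26, so "unique" is "all essential states communicate").
[cite: LevinPeres2017, §1.7 Prop. 1.29] -/
theorem LevinPeres2017_prop_1_29 [Nonempty X] (hP : IsRowStochastic P) :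
    (∃! π : X → ℝ, (∀ x, 0 ≤ π x) ∧ ∑ x, π x = 1 ∧ IsStationary π P) ↔
      ∀ x y, IsEssential P x → IsEssential P y → Communicates P x y :=
  ⟨fun h _ _ hx hy => communicates_of_existsUnique_stationary hP h hx hy,
    LevinPeres2017_prop_1_29_existsUnique hP⟩

end Literature.Probability.MarkovChains
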